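import Summits.BirchSwinnertonDyer.BirchSwinnertonDyer.Theorems.BiquadraticEisensteinDescentDeuringOfCoreLocal
import Summits.BirchSwinnertonDyer.BirchSwinnertonDyer.Theorems.RamifiedSevenEllipticUnitsDeuringShapeOfPinned
import Summits.BirchSwinnertonDyer.BirchSwinnertonDyer.Theorems.RamifiedSevenEllipticUnitsQuadraticRamificationOfPinning
import Literature.NumberTheory.EllipticCurves.HeegnerPointsKolyvaginGoodReductionProofs
import Literature.NumberTheory.EllipticCurves.CMNewformHeckeRecursionProofs
import Literature.NumberTheory.GaloisRepresentations.AlgebraicHeckeCharacterGrossencharakterProofs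
import HarnessLib

set_option linter.dupNamespace false -- `Summit.BirchSwinnertonDyer.BirchSwinnertonDyer.Theorems.…` (summit = sub)
set_option autoImplicit false

/-!
# BED route, «Deuring-ψ lane»: Deuring's theorem WITH the Grössencharacter
# (`Deuring_exists_heckeCharacter_of_maximalCM`, all five clauses) from the CORE
# «some Hecke character of infinity type `(1, 0)` is `L`-pinned to the curve»

Route `BiquadraticEisensteinDescent` of `Summits/BirchSwinnertonDyer`, crux `EisensteinHeartFlatCMInertBadKPrime`
(stmt-BirchSwinnertonDyer-21341; also `InertBadAtThree`, 19225): the conditional closers of `stub_V2`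
(`…StubV2AllJ.stub_V2_of_katz_of_deuring`) take the named fact
`Literature.NumberTheory.EllipticCurves.Deuring_exists_heckeCharacter_of_maximalCM` (Silverman, *Advanced Topics*,
II Thm. 9.2 + Thm. 10.5 (b); five clauses (i)–(v)) BY NAME. THIS FILE (theorems only; cell `bsd-wall`, width seat
`bsd-wall-cm-bed-w4` g17) reduces that named fact, for EVERY curve at once, to its CORE

  `DeuringCore W K := ∃ ψ : HeckeCharacter K, ψ.HasInfinityType (1,0) ∧ ∀ s, 3/2 < re s → heckeLFunction ψ s = W.LSeries s`

(clauses (i) ∧ (v)), by assembling theorems already in the tree: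

* (ii) equivariance and (iv) the value laws at the good primes are theorems OF THE PINNING (cell `bsd-cm`, K7r line:
  `RamifiedSevenEllipticUnits.DeuringShape.isHeckeConjEquivariant_of_pinned`,
  `….isUnramifiedAt_and_values_of_pinned_of_hasGoodReduction`), the latter needing «good primes are unramified in
  `K`», which is FILE L (`not_dvd_discr_of_hasGoodReductionAtPrime`, from the tree's ramified leaf
  `Deuring_localEulerFactor_ramified`: at a place of ramification index `2` the local factor of `E` is `1`);
* (iii) «`ψ` unramified at `w` iff `E_K` has good reduction at `w`» is NEW here: (⇐) at a good prime by (iv); a BAD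
  prime `p` of `E` stays bad at every `w ∣ p` over `K` (FILE L = `…DeuringOfCoreLocal`:
  `not_hasGoodReductionAt_baseChange_of_bad`, from the tree's PROVED prime-by-prime Deuring identity
  `Deuring_localEulerFactor_baseChange_cmField_holds` `∏_{w ∣ p} L_w(E_K)⁻¹ = (L_p(E)⁻¹)² = 1`);
  (⇒) at a bad prime the pinned character is RAMIFIED at every `w ∣ p` (§3
  `not_isUnramifiedAt_of_pinned_of_bad`: the Dirichlet coefficients `a_p = a_{p²} = 0` of an additive prime against
  `a_n = Σ_{N𝔞 = n} g(𝔞) n^{−σ}`, the tree's `Rigidity.intCast_lFunction_eq_weightedCoeff_of_heckeLFunction_eq_LSeries`;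
  split `g(w) + g(cw) = 0 = g(w)² + g(w)g(cw) + g(cw)²`, inert `g(w) = 0`, ramified = the tree's
  `Rigidity.not_isUnramifiedAt_of_heckeLFunction_eq_LSeries_of_lFunction_eq_zero`).
* §4 `deuring_of_core_at` (one curve) and **`deuring_of_core`**:
  `(∀ W K c, DeuringCore W K) → Deuring_exists_heckeCharacter_of_maximalCM`.

So the named fact's open content is EXACTLY the core (i) ∧ (v), row by row over the nine maximal CM `j`-invariants;
the companion Literature file `HeckeLFunctionEqLSeriesOfLocalFactors` reduces (v) for an explicitly constructed `ψ`
(`heckeOfGross`) to the prime-by-prime Frobenius matching. HONEST STATUS: nothing here discharges the fact; 21341 /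
19225 stay conditional; BSD is not proved for any curve.

References: [SilvermanATAEC1994] II Thm. 9.2, Cor. 10.4.1, Thm. 10.5, Ex. 2.30–2.32; [SilvermanAEC2009] VII.5,
C.16; [NeukirchANT1999] I (8.2), (9.2), VII (8.1); [LiXu2025JNT] §1.1; [Jia2026ActaArith] §1.
-/

noncomputable section

open scoped Classical ComplexConjugate NumberField
open Filter NumberField IsDedekindDomain WeierstrassCurve Polynomial ArithmeticFunction Rat.HeightOneSpectrum
  Literature.NumberTheory.GaloisRepresentations
  Literature.NumberTheory.LFunctions
  Literature.NumberTheory.EllipticCurves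
  Literature.NumberTheory.EllipticCurves.ModularForms
  Literature.NumberTheory.Automorphic
  Summit.BirchSwinnertonDyer.BirchSwinnertonDyer.Theorems.RamifiedSevenEllipticUnits

namespace Summit.BirchSwinnertonDyer.BirchSwinnertonDyer.Theorems.BiquadraticEisensteinDescentDeuringOfCore

/-! ## §3 A pinned character is RAMIFIED above every prime with `a_p = a_{p²} = 0` -/

section Pinned

variable {K : Type} [Field K] [NumberField K] {ψ : HeckeCharacter K} {V : WeierstrassCurve ℚ} {s₀ : ℝ}

/-- **A Hecke character `L`-pinned to a curve with `a_p = a_{p²} = 0` (e.g. an ADDITIVE prime) is RAMIFIED at every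
place above `p`** (`K` quadratic). With Weil's decomposition `ψ = ψ₀‖·‖^{−σ}` the pinning reads
`a_n = (Σ_{N𝔞 = n} g(𝔞)) n^{−σ}`, `g` the ideal function of `ψ₀` (ZERO exactly at the primes dividing the module
`𝔪`, at which `ψ` ramifies; tree `Rigidity.intCast_lFunction_eq_weightedCoeff_of_heckeLFunction_eq_LSeries`): at a
split `p = w·cw`, `0 = g(w) + g(cw)` and `0 = g(w)² + g(w)g(cw) + g(cw)²` give `g(w) = g(cw) = 0`; at an inert `p`,
`0 = a_{p²} = g(w) p^{−2σ}`; at a ramified `p` this is the tree's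
`Rigidity.not_isUnramifiedAt_of_heckeLFunction_eq_LSeries_of_lFunction_eq_zero`. (Silverman II Thm. 9.2 (b) with
Thm. 10.5: the character of a CM curve ramifies exactly at the bad primes — here for every pinned character.)
[cite: SilvermanATAEC1994, Ch. II Thm. 9.2 (b) and Thm. 10.5 (b) (p. 165, 171)] [cite: NeukirchANT1999, Ch. VII §8 (8.1)] -/
theorem not_isUnramifiedAt_of_pinned_of_lFunction_eq_zero (h2 : Module.finrank ℚ K = 2)
    (hpin : ∀ s : ℂ, s₀ < s.re → heckeLFunction ψ s = V.LSeries s)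
    {p : ℕ} [hp : Fact p.Prime] (ha1 : V.LFunction p = 0) (ha2 : V.LFunction (p ^ 2) = 0)
    (w : HeightOneSpectrum (𝓞 K)) (hw : ((p : ℕ) : 𝓞 K) ∈ w.asIdeal) : ¬ ψ.IsUnramifiedAt w := by
  by_cases hdvd : (p : ℤ) ∣ NumberField.discr K
  · exact Rigidity.not_isUnramifiedAt_of_heckeLFunction_eq_LSeries_of_lFunction_eq_zero h2 hdvd w hw ψ V s₀ hpin ha1
  -- the rational place `v = (p)` under `w`, unramified in `K`
  set v : HeightOneSpectrum (𝓞 ℚ) := w.under (𝓞 ℚ) with hv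
  have hwv : w.asIdeal.under (𝓞 ℚ) = v.asIdeal := rfl
  have hgen : natGenerator v = p := natGenerator_under_eq_of_natCast_mem w hp.out hw
  have he : v.asIdeal.ramificationIdxIn (𝓞 K) = 1 :=
    ramificationIdxIn_eq_one_of_not_dvd_discr (K := K) v (by rw [hgen]; exact hdvd)
  have hp0 : (p : ℂ) ≠ 0 := by exact_mod_cast hp.out.ne_zero
  -- Weil decomposition and the coefficient identity
  obtain ⟨σ, ψ₀, 𝔪, -, h𝔪, hiff, -, -, hcoeff⟩ :=
    Rigidity.intCast_lFunction_eq_weightedCoeff_of_heckeLFunction_eq_LSeries ψ V s₀ hpin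
  set g : Ideal (𝓞 K) →*₀ ℂ := rayClassCoeffHom 𝔪 fun v ↦ ψ₀.valueAtUniformizer v with hg
  have hmul : ∀ A B : Ideal (𝓞 K), A ≠ ⊥ → B ≠ ⊥ → g (A * B) = g A * g B := fun A B _ _ ↦ map_mul g A B
  have hone : g ⊤ = 1 := by rw [← Ideal.one_eq_top, map_one]
  -- `g(w') = 0` forces `𝔪 ≤ w'`, i.e. `ψ` ramified at `w'`
  have hram_of : ∀ w' : HeightOneSpectrum (𝓞 K), g w'.asIdeal = 0 → ¬ ψ.IsUnramifiedAt w' := by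
    intro w' hg0 hunr
    rw [hg, Rigidity.rayClassCoeffHom_asIdeal _ ((hiff w').mp hunr) h𝔪] at hg0
    exact HeckeCharacter.valueAtUniformizer_ne_zero' ψ₀ w' hg0
  -- the two vanishing coefficients
  have e1 := hcoeff p hp.out.ne_zero
  have e2 := hcoeff (p ^ 2) (pow_ne_zero 2 hp.out.ne_zero)
  rw [ha1, Int.cast_zero] at e1
  rw [ha2, Int.cast_zero] at e2
  have hu1 : ((p : ℕ) : ℂ) ^ (-(σ : ℂ)) ≠ 0 := fun h0 ↦ hp0 ((Complex.cpow_eq_zero_iff _ _).mp h0).1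
  have hu2 : ((p ^ 2 : ℕ) : ℂ) ^ (-(σ : ℂ)) ≠ 0 := fun h0 ↦ by
    have := ((Complex.cpow_eq_zero_iff _ _).mp h0).1
    exact pow_ne_zero 2 hp0 (by exact_mod_cast this)
  have ht1 : NumberField.twistCount K g p = 0 := (mul_eq_zero.mp e1.symm).resolve_right hu1
  have ht2 : NumberField.twistCount K g (p ^ 2) = 0 := (mul_eq_zero.mp e2.symm).resolve_right hu2
  rcases exists_places_eq_pair_or_eq_singleton h2 v he with ⟨w₁, w₂, hne, hS, h₁, h₂⟩ | ⟨w₀, hS, hw₀⟩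
  · -- SPLIT
    have hsum : ∀ e : ℕ, NumberField.twistCount K g (p ^ e) =
        ∑ i ∈ Finset.range (e + 1), g w₁.asIdeal ^ i * g w₂.asIdeal ^ (e - i) := by
      intro e
      rw [Rigidity.twistCount_eq_finsum, ← hgen]
      exact finsum_absNorm_eq_prime_pow_of_pair g hmul hone v hne hS h₁ h₂ e
    have hs1 : NumberField.twistCount K g p = g w₂.asIdeal + g w₁.asIdeal := by
      have := hsum 1
      rw [pow_one] at this
      rw [this, Finset.sum_range_succ, Finset.sum_range_succ, Finset.sum_range_zero]
      simp
    have hs2 : NumberField.twistCount K g (p ^ 2) =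
        g w₂.asIdeal ^ 2 + g w₁.asIdeal * g w₂.asIdeal + g w₁.asIdeal ^ 2 := by
      rw [hsum 2, Finset.sum_range_succ, Finset.sum_range_succ, Finset.sum_range_succ, Finset.sum_range_zero]
      simp
    set x₁ := g w₁.asIdeal with hx₁
    set x₂ := g w₂.asIdeal with hx₂
    rw [hs1] at ht1
    rw [hs2] at ht2
    have hx₁0 : x₁ = 0 := by
      have h3 : x₁ ^ 2 = 0 := by linear_combination ht2 - (x₂) * ht1
      exact pow_eq_zero_iff (two_ne_zero) |>.mp h3
    have hx₂0 : x₂ = 0 := by rw [hx₁0, add_zero] at ht1; exact ht1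
    have hwS : w ∈ ({w₁, w₂} : Set (HeightOneSpectrum (𝓞 K))) := by rw [← hS]; exact hwv
    rcases hwS with rfl | rfl
    · exact hram_of _ hx₁0
    · exact hram_of _ hx₂0
  · -- INERT
    have hw' : w = w₀ := by
      have : w ∈ ({w₀} : Set (HeightOneSpectrum (𝓞 K))) := by rw [← hS]; exact hwv
      simpa using this
    subst hw'
    have hs2 : NumberField.twistCount K g (p ^ 2) = g w.asIdeal := by
      have h := (finsum_absNorm_eq_prime_pow_of_singleton g hmul hone v hS hw₀ 1).1
      rw [hgen, show 2 * 1 = 2 from rfl, pow_one] at h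
      rw [Rigidity.twistCount_eq_finsum]; exact h
    rw [hs2] at ht2
    exact hram_of _ ht2

end Pinned

/-! ## §4 Deuring's five clauses from the core -/

section Assembly

/-- **Deuring's theorem with the Grössencharacter, for ONE curve, from its core.** Let `E/ℚ` have a globally
minimal model `W` with `W.j ∈ maximalCMJInvariants`, `K` its CM field (`IsCMFieldOfJ K W.j`), `c ≠ 1` the complex
conjugation, and suppose SOME Hecke character `ψ` of `K` of infinity type `(1, 0)` satisfies `L(s, ψ) = L(E, s)` on
`re s > 3/2` (the CORE: Silverman II Thm. 10.5 (b) with the type of Thm. 9.2 (a)). Then `ψ` has all five properties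
(i)–(v) of `Deuring_exists_heckeCharacter_of_maximalCM`: (ii) and (iv) by the K7r pinning theorems, (iii) by §2–§3.
[cite: SilvermanATAEC1994, Ch. II Thm. 9.2 (p. 164–165), Cor. 10.4.1 (p. 171), Thm. 10.5 (b) (p. 171–172), Ex. 2.30–2.32 (p. 179)]
[cite: LiXu2025JNT, §1.1] [cite: Jia2026ActaArith, §1] -/
theorem deuring_of_core_at (W : WeierstrassCurve ℚ) [W.IsElliptic] [W.IsGloballyMinimal]
    (hj : W.j ∈ maximalCMJInvariants) (K : Type) [Field K] [NumberField K] (hK : IsCMFieldOfJ K W.j)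
    (c : K ≃ₐ[ℚ] K) (hc : c ≠ 1)
    (hcore : ∃ ψ : HeckeCharacter K, ψ.HasInfinityType (fun _ ↦ 1) (fun _ ↦ 0) ∧
      ∀ s : ℂ, 3 / 2 < s.re → heckeLFunction ψ s = W.LSeries s) :
    ∃ ψ : HeckeCharacter K,
      ψ.HasInfinityType (fun _ ↦ 1) (fun _ ↦ 0) ∧
      IsHeckeConjEquivariant c ψ ∧
      (∀ w : HeightOneSpectrum (𝓞 K), ψ.IsUnramifiedAt w ↔ (W.baseChange K).HasGoodReductionAt w) ∧
      (∀ (p : ℕ) [Fact p.Prime], W.HasGoodReductionAtPrime p →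
        ∀ w : HeightOneSpectrum (𝓞 K), (p : 𝓞 K) ∈ w.asIdeal →
          ψ.IsUnramifiedAt w ∧
          (c • w ≠ w →
            ψ.valueAtUniformizer w + ψ.valueAtUniformizer (c • w) = (W.frobeniusTrace p : ℂ) ∧
            ψ.valueAtUniformizer w * ψ.valueAtUniformizer (c • w) = (p : ℂ)) ∧
          (c • w = w → W.frobeniusTrace p = 0 ∧ ψ.valueAtUniformizer w = -(p : ℂ))) ∧
      ∀ s : ℂ, 3 / 2 < s.re → heckeLFunction ψ s = W.LSeries s := by
  obtain ⟨ψ, hinf, hpin⟩ := hcore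
  have hIQ : IsImaginaryQuadratic K := Deuring_exists_heckeCharacter_of_maximalCM.isImaginaryQuadratic hj hK
  have hCM : W.HasCM := hasCM_of_j_mem_cmJInvariants W (maximalCMJInvariants_subset_cmJInvariants hj)
  refine ⟨ψ, hinf, DeuringShape.isHeckeConjEquivariant_of_pinned hIQ c hc hinf W (3 / 2) hpin, fun w ↦ ?_,
    fun p _ hgood w hw ↦ DeuringShape.isUnramifiedAt_and_values_of_pinned_of_hasGoodReduction hK.1 c hc hpin hgood
      (not_dvd_discr_of_hasGoodReductionAtPrime W hj hK hgood) w hw, hpin⟩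
  -- clause (iii) at `w`: over the prime `p` below `w`
  set v : HeightOneSpectrum (𝓞 ℚ) := w.under (𝓞 ℚ) with hv
  set p : ℕ := natGenerator v with hp
  haveI hpF : Fact p.Prime := ⟨prime_natGenerator v⟩
  have hw : ((p : ℕ) : 𝓞 K) ∈ w.asIdeal := (asIdeal_under_eq_iff_natCast_mem v w).mp rfl
  by_cases hgood : W.HasGoodReductionAtPrime p
  · -- good prime: both sides hold
    have hgv : W.HasGoodReductionAt v := (hasGoodReductionAtPrime_iff_hasGoodReductionAt_ringOfIntegers v W).mp hgood
    haveI : w.asIdeal.LiesOver v.asIdeal := ⟨rfl⟩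
    exact iff_of_true
      (DeuringShape.isUnramifiedAt_and_values_of_pinned_of_hasGoodReduction hK.1 c hc hpin hgood
        (not_dvd_discr_of_hasGoodReductionAtPrime W hj hK hgood) w hw).1
      (hasGoodReductionAt_baseChange_of_hasGoodReductionAt_rat W v w hgv)
  · -- bad prime: both sides fail
    have hbadv : ¬ W.HasGoodReductionAt v := fun h ↦
      hgood ((hasGoodReductionAtPrime_iff_hasGoodReductionAt_ringOfIntegers v W).mpr h)
    have hadd : W.HasAdditiveReductionAt v := hasAdditiveReductionAt_of_hasCM_of_bad W hCM v hbadv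
    have hpv : (primesEquiv v : ℕ) = p := rfl
    have ha1 : W.LFunction p = 0 :=
      W.LFunction_apply_eq_zero_of_hasAdditiveReductionAt (p := p) (v := v) hpv hadd (dvd_refl p)
    have ha2 : W.LFunction (p ^ 2) = 0 :=
      W.LFunction_apply_eq_zero_of_hasAdditiveReductionAt (p := p) (v := v) hpv hadd (dvd_pow_self p two_ne_zero)
    exact iff_of_false (not_isUnramifiedAt_of_pinned_of_lFunction_eq_zero hK.1 hpin ha1 ha2 w hw)
      (not_hasGoodReductionAt_baseChange_of_bad W hj hK hgood w hw)

/-- **`Deuring_exists_heckeCharacter_of_maximalCM` FROM ITS CORE.** If for every globally minimal elliptic `W/ℚ` with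
`W.j ∈ maximalCMJInvariants` and its CM field `K` SOME Hecke character of `K` of infinity type `(1, 0)` is `L`-pinned to
`W` on `re s > 3/2` (Silverman II Thm. 10.5 (b) with Thm. 9.2 (a)), then the named fact holds with all five clauses.
The open content of the fact is thus exactly this core, row by row over the nine maximal CM `j`-invariants.
[cite: SilvermanATAEC1994, Ch. II Thm. 9.2 and Thm. 10.5 (b) (p. 164–172)] -/
theorem deuring_of_core
    (hcore : ∀ (W : WeierstrassCurve ℚ) [W.IsElliptic] [W.IsGloballyMinimal], W.j ∈ maximalCMJInvariants →
      ∀ (K : Type) [Field K] [NumberField K], IsCMFieldOfJ K W.j →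
        ∃ ψ : HeckeCharacter K, ψ.HasInfinityType (fun _ ↦ 1) (fun _ ↦ 0) ∧
          ∀ s : ℂ, 3 / 2 < s.re → heckeLFunction ψ s = W.LSeries s) :
    Deuring_exists_heckeCharacter_of_maximalCM := by
  intro W _ _ hj K _ _ hK c hc
  exact deuring_of_core_at W hj K hK c hc (hcore W hj K hK)

end Assembly

end Summit.BirchSwinnertonDyer.BirchSwinnertonDyer.Theorems.BiquadraticEisensteinDescentDeuringOfCore
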